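import Literature.AlgebraicGeometry.Frobenioids.DivisorMonoidBirationalPerfectProofs
import Literature.AlgebraicGeometry.Frobenioids.BaseCategoryTheoreticityDefs
import Literature.AlgebraicGeometry.Frobenioids.IsotropicFrobenioid
import Mathlib.Data.Nat.PrimeFin
import HarnessLib

/-!
# Frobenioids I, toward Proposition 4.8 (iii): the birationalization of a Frobenioid of isotropic
# type has no anchors — quasi-isotropic and Frobenius-isotropic type, non-dilating divisors, and
# "standard type" modulo conditions (b), (c) of Def. 3.1 (i)

Mochizuki, *The geometry of Frobenioids I: the general theory*, Kyushu J. Math. **62** (2008)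
293–400, §4, Proposition 4.8 (iii), kurims text p. 88 [cite: MochizukiFrdI2008, Prop. 4.8 (iii) p.88]:
"(iii) If `C` is of rationally standard type, then `(C^istr)^birat` is of standard type" ("follows
formally from the definitions [cf. also assertion (i)]"); Def. 3.1 (i) p. 56 (standard type = (a)
quasi-isotropic and Frobenius-isotropic type, (b) a Frobenius-compact object of `C^istr` if `C` is
group-like, (c) Frobenius-normalized type, (d) `D` of FSMFF-type, (e) `Φ` non-dilating); §0 p. 18
(anchors, subanchors, iso-subanchors).

PROOF-ONLY file (theorems only), for THE birationalization `C^birat → F_{0_D}` (`Birat.toElemZero`)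
of a Frobenioid `C` OF ISOTROPIC TYPE (so `C^istr = C`), continuing
`DivisorMonoidBirationalTypesProofs.lean` / `DivisorMonoidBirationalPerfectProofs.lean`:

* `Birat.isIrreducibleHom_toBirat_map` — the image of a base-isomorphism of `C` of PRIME Frobenius
  degree is an irreducible arrow of `C^birat` (degrees multiply; a degree-`1` factor is a pre-step of
  `C^birat` — `D` totally epimorphic — hence an isomorphism by Prop. 4.8 (i));
* `Birat.not_isAnchor`, `Birat.not_isSubanchor`, `Birat.not_isIsoSubanchor` — NO object of `C^birat`
  is an anchor (the images of morphisms of Frobenius type of the infinitely many prime degrees out of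
  `A`, Def. 1.3 (ii), are pairwise non-isomorphic irreducible objects of `^A C^birat`), hence none is a
  subanchor or an iso-subanchor;
* `PreFrobenioidData.isOfQuasiIsotropicType_ofFunctor_toElemZero` (condition (a), first half: every
  object is isotropic and none is an iso-subanchor), `…isOfFrobeniusIsotropicType…` ((a), second half),
  `…isNonDilatingOn_ofFunctor_toElemZero` ((e) for the zero monoid `0_D`);
* `PreFrobenioidData.isOfStandardType_ofFunctor_toElemZero_of` — (a), (d), (e) discharged, with (b)
  (a Frobenius-compact isotropic object, which Def. 4.5 (iii)(b) is there to supply) and (c)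
  (Frobenius-normalized type of `C^birat`, i.e. "birationally Frobenius-normalized", Def. 4.5 (iii)(a))
  as the explicit remaining hypotheses — an honest PARTIAL discharge of node `FrdI:Prop4.8(iii)`:
  the `C^istr`-layer (for `C` not of isotropic type) and the transfer of Frobenius-compactness from
  `(C^un-tr)^birat` are NOT done here.

Seat abc-iut-L6-t20 (abc-iut cell). No statement of the paper is strengthened; nothing here concerns
the disputed parts of IUT.
-/

namespace Literature.AlgebraicGeometry.Frobenioids

open CategoryTheory Opposite

universe w v v' u u'

namespace PreFrobenioid

namespace Birat

variable {D : Type u} [Category.{v} D] {Φ : Dᵒᵖ ⥤ CommMonCat.{w}}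
  {C : Type u'} [Category.{v'} C] {F : C ⥤ ElemFrobenioid Φ}
  {hF : IsFrobenioid F} {hsq : HasBiratSquares F}

/-! ### Irreducible arrows of `C^birat` -/

/-- An isomorphism of `C^birat` has Frobenius degree `1`. [cite: MochizukiFrdI2008, Rem. 1.1.1 p.21] -/
theorem degFr_eq_one_of_isIso {X Y : Birat F hF hsq} (ψ : X ⟶ Y) [IsIso ψ] :
    degFr (toElemZero hF hsq) ψ = 1 :=
  isLinear_of_isIso (toElemZero hF hsq) ψ

/-- For `C` of isotropic type: the image in `C^birat` of a base-isomorphism `φ` of `C` of PRIME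
Frobenius degree is an irreducible arrow — in a factorisation `φ^birat = β ≫ α` the degrees multiply to
a prime, so one factor is linear, and both are base-isomorphisms (`D` totally epimorphic), so that
factor is a pre-step of `C^birat`, hence an isomorphism (Prop. 4.8 (i)).
[cite: MochizukiFrdI2008, Prop. 4.8 (iii) p.88] -/
theorem isIrreducibleHom_toBirat_map (hiso : IsOfIsotropicType F) {A B : C} (φ : A ⟶ B)
    (hb : IsBaseIso F φ) (hp : (degFr F φ : ℕ).Prime) :
    IsIrreducibleHom ((toBirat F hF hsq).map φ) := by
  have hD : IsTotallyEpimorphic D := hF.isPreFrobenioid.isTotallyEpimorphic_base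
  refine ⟨fun h => ?_, fun X β α hfac => ?_⟩
  · have h1 : degFr (toElemZero hF hsq) ((toBirat F hF hsq).map φ) = 1 :=
      degFr_eq_one_of_isIso _
    rw [degFr_toElemZero_map] at h1
    rw [h1] at hp
    exact Nat.not_prime_one hp
  · have hbZ : IsBaseIso (toElemZero hF hsq) (β ≫ α) := by
      rw [hfac]; exact isBaseIso_toElemZero_map hb
    obtain ⟨hαb, hβb⟩ := isBaseIso_factors (toElemZero hF hsq) hD hbZ
    have hdeg : (degFr (toElemZero hF hsq) β : ℕ) * degFr (toElemZero hF hsq) α = degFr F φ := by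
      rw [← PNat.mul_coe, ← degFr_comp, hfac]; rfl
    rw [← hdeg] at hp
    rcases (Nat.prime_mul_iff.mp hp) with ⟨-, h1⟩ | ⟨-, h1⟩
    · -- `deg α = 1`: `α` is a pre-step, hence an isomorphism
      left
      exact isIso_of_isPreStep hiso α ⟨PNat.coe_inj.mp (h1.trans PNat.one_coe.symm), hαb⟩
    · right
      exact isIso_of_isPreStep hiso β ⟨PNat.coe_inj.mp (h1.trans PNat.one_coe.symm), hβb⟩

/-! ### No anchors in `C^birat` -/

/-- For `C` a Frobenioid of isotropic type, NO object of `C^birat` is an anchor (§0 p. 18): out of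
`A` there are morphisms of Frobenius type of every prime degree `p` (Def. 1.3 (ii)); their images are
irreducible arrows of `C^birat` and pairwise non-isomorphic as objects of `^A C^birat` (an isomorphism
under `A^birat` preserves the Frobenius degree), so infinitely many isomorphism classes of `^A C^birat`
arise from irreducible arrows. [cite: MochizukiFrdI2008, Prop. 4.8 (iii) p.88] -/
theorem not_isAnchor (hiso : IsOfIsotropicType F) (X : Birat F hF hsq) : ¬ IsAnchor X := by
  intro hfin
  -- a morphism of Frobenius type of each prime degree out of `X.out`
  have hex : ∀ p : Nat.Primes, ∃ (B : C) (φ : X.out ⟶ B),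
      IsFrobeniusType F φ ∧ degFr F φ = ⟨p.1, p.2.pos⟩ := fun p => hF.ii_exists X.out ⟨p.1, p.2.pos⟩
  choose B φ hφ hd using hex
  -- the corresponding objects of `Under X` and their classes
  let u : Nat.Primes → Under X := fun p => Under.mk (Y := (toBirat F hF hsq).obj (B p))
    ((toBirat F hF hsq).map (φ p))
  let cl : Nat.Primes → Quotient (isIsomorphicSetoid (Under X)) := fun p => Quotient.mk _ (u p)
  have hirr : ∀ p, IsIrreducibleHom (u p).hom := fun p =>
    isIrreducibleHom_toBirat_map hiso (φ p) (hφ p).2 (by rw [hd p]; exact p.2)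
  have hmem : ∀ p, cl p ∈ {x : Quotient (isIsomorphicSetoid (Under X)) |
      ∃ f : Under X, IsIrreducibleHom f.hom ∧ Quotient.mk _ f = x} := fun p => ⟨u p, hirr p, rfl⟩
  have hinj : Function.Injective cl := by
    intro p q hpq
    obtain ⟨e⟩ := Quotient.exact hpq
    -- degrees: `deg (φ p)^birat * deg e.hom.right = deg (φ q)^birat`, and `e.hom.right` is an iso
    have hw : (u p).hom ≫ e.hom.right = (u q).hom := Under.w e.hom
    haveI : IsIso e.hom.right := (Under.forget X).map_isIso e.hom
    have hdeg := congrArg (fun g => (degFr (toElemZero hF hsq) g : ℕ)) hw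
    simp only [degFr_comp, degFr_eq_one_of_isIso, mul_one] at hdeg
    change (degFr F (φ p) : ℕ) = degFr F (φ q) at hdeg
    rw [hd p, hd q] at hdeg
    exact Subtype.ext hdeg
  exact (Set.infinite_of_injective_forall_mem hinj hmem) hfin

/-- … hence no object of `C^birat` is a subanchor … [cite: MochizukiFrdI2008, Prop. 4.8 (iii) p.88] -/
theorem not_isSubanchor (hiso : IsOfIsotropicType F) (X : Birat F hF hsq) : ¬ IsSubanchor X :=
  fun ⟨B, hB, _⟩ => not_isAnchor hiso B hB

/-- … hence no object of `C^birat` is an iso-subanchor. [cite: MochizukiFrdI2008, Prop. 4.8 (iii) p.88] -/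
theorem not_isIsoSubanchor (hiso : IsOfIsotropicType F) (X : Birat F hF hsq) : ¬ IsIsoSubanchor X :=
  fun ⟨B, _, _, hB, _⟩ => not_isSubanchor hiso B hB

end Birat

end PreFrobenioid

/-! ### Def. 3.1 (i) conditions for `C^birat → F_{0_D}` through the §3–§4 statement interface -/

namespace PreFrobenioidData

variable {D : Type u} [Category.{v} D] {Φ : Dᵒᵖ ⥤ CommMonCat.{w}}
  {C : Type u'} [Category.{v'} C] {F : C ⥤ ElemFrobenioid Φ}
  (hF : PreFrobenioid.IsFrobenioid F) (hsq : PreFrobenioid.HasBiratSquares F)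

/-- Condition (a), first half, of Def. 3.1 (i) for the birationalization of a Frobenioid of isotropic
type: `C^birat` is of quasi-isotropic type — every object is isotropic (Prop. 4.8 (i)) and none is an
iso-subanchor (no anchors). [cite: MochizukiFrdI2008, Def. 3.1 (i) p.56] -/
theorem isOfQuasiIsotropicType_ofFunctor_toElemZero (hiso : PreFrobenioid.IsOfIsotropicType F) :
    (ofFunctor (zeroMonoid D) (PreFrobenioid.Birat.toElemZero hF hsq)).IsOfQuasiIsotropicType := by
  refine ⟨fun X => ⟨fun h => ?_, fun h => ?_⟩⟩
  · exact (h ((ofFunctor_isIsotropic _ X).mpr (PreFrobenioid.Birat.isIsotropic hiso X))).elim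
  · exact (PreFrobenioid.Birat.not_isIsoSubanchor hiso X h).elim

/-- Condition (a), second half: `C^birat` is of Frobenius-isotropic type (the identity is of Frobenius
type and every object is isotropic). [cite: MochizukiFrdI2008, Def. 3.1 (i) p.56] -/
theorem isOfFrobeniusIsotropicType_ofFunctor_toElemZero (hiso : PreFrobenioid.IsOfIsotropicType F) :
    (ofFunctor (zeroMonoid D) (PreFrobenioid.Birat.toElemZero hF hsq)).IsOfFrobeniusIsotropicType := by
  refine ⟨fun X => ⟨X, 𝟙 X, ?_, ?_⟩⟩
  · exact (ofFunctor_isFrobeniusType _ _).mpr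
      ((PreFrobenioid.Birat.isFrobeniusType_iff_isBaseIso hiso _).mpr
        (PreFrobenioid.isBaseIso_of_isIso _ _))
  · exact (ofFunctor_isIsotropic _ X).mpr (PreFrobenioid.Birat.isIsotropic hiso X)

/-- Condition (e): the zero monoid `0_D` is non-dilating (its characteristic `(0_D(X))^char` is the
one-element monoid). [cite: MochizukiFrdI2008, Def. 3.1 (i) p.56] -/
theorem isNonDilatingOn_ofFunctor_zeroMonoid {E : Type u'} [Category.{v'} E]
    (G : E ⥤ ElemFrobenioid (zeroMonoid D)) : (ofFunctor (zeroMonoid D) G).IsNonDilatingOn := by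
  refine ⟨fun X f _ a => ?_⟩
  induction a using Quotient.inductionOn with
  | h a => rfl

/-- **Toward [FrdI] Prop. 4.8 (iii)** — Def. 3.1 (i) "standard type" for the birationalization
`C^birat → F_{0_D}` of a Frobenioid of ISOTROPIC type over a base of FSMFF-type: conditions (a)
(quasi-isotropic + Frobenius-isotropic: no anchors, Prop. 4.8 (i)), (d) (given) and (e) (zero monoid)
are discharged here; (b) (a Frobenius-compact [isotropic] object — what Def. 4.5 (iii)(b) supplies) and
(c) (Frobenius-normalized type of `C^birat` = "birationally Frobenius-normalized", Def. 4.5 (i)/(iii)(a))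
remain explicit hypotheses. PARTIAL, honest discharge of node `FrdI:Prop4.8(iii)` (the `C^istr`-layer
for non-isotropic `C` and the transfer of Frobenius-compactness from `(C^un-tr)^birat` are not done).
[cite: MochizukiFrdI2008, Prop. 4.8 (iii) p.88] -/
theorem isOfStandardType_ofFunctor_toElemZero_of (hiso : PreFrobenioid.IsOfIsotropicType F)
    (hD : IsOfFSMFFType D)
    (hb : ∃ A, (ofFunctor (zeroMonoid D) (PreFrobenioid.Birat.toElemZero hF hsq)).IsFrobeniusCompact A)
    (hc : (ofFunctor (zeroMonoid D) (PreFrobenioid.Birat.toElemZero hF hsq)).IsOfFrobeniusNormalizedType) :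
    (ofFunctor (zeroMonoid D) (PreFrobenioid.Birat.toElemZero hF hsq)).IsOfStandardType where
  quasiIsotropic := isOfQuasiIsotropicType_ofFunctor_toElemZero hF hsq hiso
  frobeniusIsotropic := isOfFrobeniusIsotropicType_ofFunctor_toElemZero hF hsq hiso
  frobeniusCompact_of_groupLike _ := by
    obtain ⟨A, hA⟩ := hb
    exact ⟨A, (ofFunctor_isIsotropic _ A).mpr (PreFrobenioid.Birat.isIsotropic hiso A), hA⟩
  frobeniusNormalized := hc
  fsmff := hD
  nonDilating := isNonDilatingOn_ofFunctor_zeroMonoid _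

/-! ### The same for `(C^istr)^birat`, `C` an ARBITRARY Frobenioid (`C^istr` is a Frobenioid of
isotropic type: `isFrobenioid_istr`, `isOfIsotropicType_istr`) -/

/-- **[FrdI] Prop. 4.8 (i) for `(C^istr)^birat`**, `C` any Frobenioid: the birationalization of
`C^istr` is of isotropic type. [cite: MochizukiFrdI2008, Prop. 4.8 (i) p.88] -/
theorem isOfIsotropicType_ofFunctor_toElemZero_istr
    (hsq' : PreFrobenioid.HasBiratSquares (PreFrobenioid.istrFunctor F)) :
    (ofFunctor (zeroMonoid D)
      (PreFrobenioid.Birat.toElemZero (PreFrobenioid.isFrobenioid_istr hF) hsq')).IsOfIsotropicType :=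
  ⟨fun X => (ofFunctor_isIsotropic _ X).mpr
    (PreFrobenioid.Birat.isIsotropic (PreFrobenioid.isOfIsotropicType_istr (F := F)) X)⟩

/-- **Toward [FrdI] Prop. 4.8 (iii)**, `C` ANY Frobenioid over a base of FSMFF-type: `(C^istr)^birat`
(`→ F_{0_D}`) is of standard type as soon as it admits a Frobenius-compact object (Def. 3.1 (i)(b))
and is of Frobenius-normalized type ((c)); conditions (a), (d), (e) are discharged (no anchors in the
birationalization of the isotropic-type Frobenioid `C^istr`). The printed hypothesis "`C` of rationally
standard type" (Def. 4.5 (iii)) is there to supply (b), (c), (d); that derivation is the recorded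
residual of the node. [cite: MochizukiFrdI2008, Prop. 4.8 (iii) p.88] -/
theorem isOfStandardType_ofFunctor_toElemZero_istr_of
    (hsq' : PreFrobenioid.HasBiratSquares (PreFrobenioid.istrFunctor F)) (hD : IsOfFSMFFType D)
    (hb : ∃ A, (ofFunctor (zeroMonoid D)
      (PreFrobenioid.Birat.toElemZero (PreFrobenioid.isFrobenioid_istr hF) hsq')).IsFrobeniusCompact A)
    (hc : (ofFunctor (zeroMonoid D)
      (PreFrobenioid.Birat.toElemZero (PreFrobenioid.isFrobenioid_istr hF) hsq')).IsOfFrobeniusNormalizedType) :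
    (ofFunctor (zeroMonoid D)
      (PreFrobenioid.Birat.toElemZero (PreFrobenioid.isFrobenioid_istr hF) hsq')).IsOfStandardType :=
  isOfStandardType_ofFunctor_toElemZero_of (PreFrobenioid.isFrobenioid_istr hF) hsq'
    (PreFrobenioid.isOfIsotropicType_istr (F := F)) hD hb hc

end PreFrobenioidData

end Literature.AlgebraicGeometry.Frobenioids
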